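import Summits.CriticalPhenomena.SAWScalingLimit.Theorems.SAWLeftRightFKGFKGToTraversalBoundSlitNecklacePieces
import HarnessLib

/-!
# Necklace assembly (far-tip form), part 6: the swallowed case carries no traversals

Crux `SAWLeftRightFKG.FKGToTraversalBound` (stmt-CriticalPhenomena-1878), line `slit-necklace`
(reshape r4), stub `stub_necklaceAssemblyFar`, the degenerate alternative of the defect normalisation
`tamePresentation_attached` (p135403): some non-isolated vertex `k` of `Ω_δ` has all its `Ω_δ`-reachable
vertices inside the defect set `S'`.

Claim (`necklace_swallowed_noTraversals`).  If moreover the discrete domain `meshDomain Ω δ` is connected in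
the mesh graph (true for all small meshes of a Jordan domain: `JordanDomain.eventually_forall_mem_meshDomain'`),
then every self-avoiding chord `γ` of `Ω_δ` has at most `#S'` vertices, hence its mesh polyline does NOT make
`2 (#S' + 1)` separate traversals of any shell `D(x; ρ, R)` with `ρ + δ < R - δ`.

Proof.  `meshDomain` is a union of (maximal) mesh components, so a mesh-graph walk on mesh vertices that
starts in `meshDomain` stays in it, and is a walk of `Ω_δ` (`reachable_of_meshReachable`); thus the start of a
non-trivial chord is `Ω_δ`-reachable from `k`, every vertex of the chord is reachable from its start, and the
(duplicate-free) vertex list of the chord lies in `S'`.  On the other hand `2 (#S' + 1)` separate traversals give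
`#S' + 1` strictly separated index windows (`exists_sepIndexTraversals_of_hasTraversals_toCurve`, p115507),
whose left ends are `#S' + 1` distinct indices `≤ |γ|`.

Only theorems; no named fact; axioms are the standard three.
-/

noncomputable section

open Set Metric
open Literature.Probability.LatticeModels
open Literature.Probability.RandomPlanarGeometry
open Literature.Probability.RandomPlanarGeometry.SAW

namespace Summit.CriticalPhenomena.SAWScalingLimit.Theorems.FKGToTraversalBound.SlitNecklace

/-- `meshDomain` is closed under adjacency of the mesh graph on mesh vertices (it is a union of connected
components). [folklore] -/
private theorem mem_meshDomain_of_meshAdj {Ω : Set ℂ} {δ : ℝ} {x y : Site 2} (hx : x ∈ meshDomain Ω δ)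
    (hxV : x ∈ meshVertices Ω δ) (hyV : y ∈ meshVertices Ω δ)
    (hadj : (meshVertexGraph Ω δ).Adj ⟨x, hxV⟩ ⟨y, hyV⟩) : y ∈ meshDomain Ω δ := by
  simp only [meshDomain, mem_iUnion, mem_image] at hx ⊢
  obtain ⟨C, hC, x', hx'C, hx'x⟩ := hx
  refine ⟨C, hC, ⟨y, hyV⟩, ?_, rfl⟩
  rw [SimpleGraph.ConnectedComponent.mem_supp_iff] at hx'C ⊢
  have hxx' : x' = ⟨x, hxV⟩ := Subtype.ext hx'x
  subst hxx'
  rw [← hx'C]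
  exact (SimpleGraph.ConnectedComponent.connectedComponentMk_eq_of_adj hadj).symm

/-- A mesh-graph walk on mesh vertices from a point of `meshDomain` is a walk of `Ω_δ`. [folklore] -/
private theorem reachable_of_meshReachable {Ω : Set ℂ} {δ : ℝ} :
    ∀ {x y : meshVertices Ω δ} (p : (meshVertexGraph Ω δ).Walk x y), (x : Site 2) ∈ meshDomain Ω δ →
      (discreteDomainGraph Ω δ).Reachable (x : Site 2) (y : Site 2) := by
  intro x y p
  induction p with
  | nil => exact fun _ => SimpleGraph.Reachable.refl _
  | @cons x₀ x₁ _ hadj p₁ ih =>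
    intro hx₀
    have hx₁ : (x₁ : Site 2) ∈ meshDomain Ω δ := mem_meshDomain_of_meshAdj hx₀ x₀.2 x₁.2 hadj
    have hstep : (discreteDomainGraph Ω δ).Adj (x₀ : Site 2) (x₁ : Site 2) :=
      discreteDomainGraph_adj_iff.2 ⟨hadj, hx₀, hx₁⟩
    exact hstep.reachable.trans (ih hx₁)

/-- **Registered part of `stub_necklaceAssemblyFar`: the swallowed case carries no traversals** (see the
module docstring). [folklore] -/
theorem necklace_swallowed_noTraversals : ∀ (Ω : Set ℂ) (δ : ℝ) (S' : Finset (Site 2)) (k a₀ b₀ : Site 2)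
    (γ : DomainSAW Ω δ a₀ b₀) (x : ℂ) (ρ R : ℝ), 0 ≤ δ → ρ + δ < R - δ →
    (∀ x' ∈ meshDomain Ω δ, ∀ y' ∈ meshDomain Ω δ,
      ∃ (hx : x' ∈ meshVertices Ω δ) (hy : y' ∈ meshVertices Ω δ),
        (meshVertexGraph Ω δ).Reachable ⟨x', hx⟩ ⟨y', hy⟩) →
    (∃ w, (discreteDomainGraph Ω δ).Adj k w) →
    (∀ y, (discreteDomainGraph Ω δ).Reachable k y → y ∈ S') →
    ¬ (polyline γ).HasTraversals (2 * (S'.card + 1)) x ρ R := by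
  intro Ω δ S' k a₀ b₀ γ x ρ R hδ hρR hconn hk hswallow htrav
  classical
  have hle : discreteDomainGraph Ω δ ≤ zdGraph 2 :=
    (discreteDomainGraph_le_meshGraph Ω δ).trans (meshGraph_le_zdGraph Ω δ)
  -- `#S' + 1` strictly separated index windows: `#S' ≤ |γ|`
  obtain ⟨i, j, hij, hj, -, hsep⟩ :=
    ExcursionDomination.ShellIteration.exists_sepIndexTraversals_of_hasTraversals_toCurve hδ (meshPoint δ)
      (ExcursionDomination.ShellIteration.dist_meshPoint_le_of_le_zdGraph hle hδ) γ.walk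
      (r' := ρ + δ) (R' := R - δ) le_rfl le_rfl hρR htrav
  have hcard_le : S'.card ≤ γ.walk.length := by
    set f : Fin (S'.card + 1) → Fin (γ.walk.length + 1) :=
      fun m => ⟨i m, Nat.lt_succ_of_le ((hij m).trans (hj m))⟩ with hf
    have hmono : StrictMono f := fun m m' hmm' => by
      change i m < i m'
      exact (hij m).trans_lt (hsep hmm')
    have := Fintype.card_le_of_injective f hmono.injective
    simp only [Fintype.card_fin] at this
    omega
  -- `k ∈ S'`, so the chord is non-trivial
  have hkS : k ∈ S' := hswallow k (SimpleGraph.Reachable.refl _)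
  have hlen : 0 < γ.walk.length := by
    have : 0 < S'.card := Finset.card_pos.2 ⟨k, hkS⟩
    omega
  -- the start of the chord is `Ω_δ`-reachable from `k` (connectivity of `meshDomain`)
  have hadj₀ := γ.walk.adj_getVert_succ hlen
  rw [SimpleGraph.Walk.getVert_zero] at hadj₀
  have ha₀ : a₀ ∈ meshDomain Ω δ := (discreteDomainGraph_adj_iff.1 hadj₀).2.1
  obtain ⟨w, hkw⟩ := hk
  have hkD : k ∈ meshDomain Ω δ := (discreteDomainGraph_adj_iff.1 hkw).2.1
  obtain ⟨hkV, haV, ⟨q⟩⟩ := hconn k hkD a₀ ha₀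
  have hka₀ : (discreteDomainGraph Ω δ).Reachable k a₀ := reachable_of_meshReachable q hkD
  -- every vertex of the chord lies in `S'`
  have hsupp : ∀ z ∈ γ.walk.support, z ∈ S' := fun z hz =>
    hswallow z (hka₀.trans ⟨γ.walk.takeUntil z hz⟩)
  -- so the chord has at most `#S'` vertices
  have hlen_le : γ.walk.length + 1 ≤ S'.card := by
    rw [← SimpleGraph.Walk.length_support, ← List.toFinset_card_of_nodup γ.isPath.support_nodup]
    exact Finset.card_le_card fun z hz => hsupp z (List.mem_toFinset.1 hz)
  omega

end Summit.CriticalPhenomena.SAWScalingLimit.Theorems.FKGToTraversalBound.SlitNecklace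

end
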